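import Literature.Computability.AlgebraicComplexity.BI17GenericDegreeMonoidSmallCases
import Literature.Computability.AlgebraicComplexity.CoordRepRational
import Literature.Computability.AlgebraicComplexity.PlethysmLifting
import Literature.Computability.AlgebraicComplexity.DIP20PlethysmValuesRow3
import Literature.RepresentationTheory.GeneralLinear.RectangularHighestWeightSemiInvariant
import HarnessLib

/-!
# `O(Sym^D ℂ^m)^{SL_m}_d` IS the highest-weight space of the rectangle `m × (Dd/m)`:
# `dim O(Sym^D ℂ^m)^{SL_m}_d = a_{((Dd/m)^m)}(d[D])`, and BI 2017 Ex. 3.7 for `E(4,4)`, `E(3,3)`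

Topic `Literature/Computability/AlgebraicComplexity`; theorems only (no definitions, no named
facts). Companion of `BI17FundamentalInvariantForms.lean` (val-lit-t04; named fact `BI2017_ex_3_7`)
and of `BI17GenericDegreeMonoidSmallCases.lean` (this seat): P. Bürgisser, C. Ikenmeyer,
*Fundamental invariants of orbit closures*, J. Algebra 477 (2017) = arXiv:1511.02927, Rem. 3.13
(main.tex L1100: "The degree `d` invariant space `O(Sym^D ℂ^m)_d^{SL_m}` is generated by the
invariants `P_T`, `T` semistandard of shape `m × s`" — i.e. it is the isotypic/highest-weight space
of the rectangle) and Example 3.7 (L823).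

* §1 **`slInvariantsOfDegree (Fin m) ℂ D d = HW_{(-(Dd/m))^m}(ℂ[Sym^D])`** (`m ∣ Dd`, `D ≥ 1`):
  `≤` is t01's `slInvariantsOfDegree_le_highestWeightSpace`; `≥` is NEW — a highest-weight vector of
  constant weight in the rational representation `ℂ[Sym^D]` (`isRationalRep_coordRep`) is a
  `det^c`-semi-invariant (`apply_eq_self_of_mem_highestWeightSpace_const_of_det_eq_one`,
  `RectangularHighestWeightSemiInvariant.lean`), hence `SL_m`-invariant, and homogeneous of degree
  `d` because the weight pins the degree (`isHomogeneous_of_mem_highestWeightSpace`). Consequently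
  **`dim O(Sym^D ℂ^m)^{SL_m}_d = plethysmCoeff ℂ (Fin m) D (-(Dd/m), …)` = `a_{(s^m)}(d[D])`**
  (`finrank_slInvariantsOfDegree_eq_plethysmCoeff`) and
  `d ∈ E(D,m) ↔ a_{(s^m)}(d[D]) ≠ 0` (`mem_genericDegreeMonoid_iff_plethysmCoeff_ne_zero`):
  every generic-degree-monoid question is a plethysm computation.
* §2 three KERNEL plethysm values (`decide +kernel`, no `native_decide`): `a_{(6^4)}(6[4]) = 1`,
  `a_{(7^4)}(7[4]) = 1` (p4 g3's packed table DP `plethysmCoeff_fin_four_cast_eq_dp`) and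
  `a_{(6,6,6)}(6[3]) = 1` (p6's `plethysmCoeff_fin_three_cast_eq_six_counts`, Aronhold's `T`);
  hence `6, 7 ∈ E(4,4)` and `6 ∈ E(3,3)`.
* §3 **BI 2017 Ex. 3.7, third display, PROVED**: `E(4,4) = ℕ ∖ {1,2,3,5,9}`
  (`genericDegreeMonoid_four_four`; with `genericMinimalDegree_four_four : e(4,4) = 4` of the
  companion file); and `E(3,3) ⊇ 2(ℕ ∖ {1})` (`mem_genericDegreeMonoid_three_three_of_even'`),
  `E(2,2) ⊇ 2ℕ`.
* §4 the reduction of the whole named fact to the two ODD-DEGREE VANISHING statements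
  `a_{(d,d)}(d[2]) = 0` and `a_{(d,d,d)}(d[3]) = 0` for odd `d` (`BI2017_ex_3_7_of_odd_vanishing`):
  binary quadrics (classical, `ℂ[disc]`) and ternary cubics (Aronhold: `ℂ[S,T]`, `deg S = 4`,
  `deg T = 6`) have no invariants of odd degree. These are NOT finite computations; they are
  discharged (binary) resp. attacked (ternary) in sibling files.

HONEST FRAMING (cell `val-lit`, rung V3, row BI17): classical invariant theory of binary quadrics /
ternary cubics / quaternary quartics as typed-fact bookkeeping; nothing here bears on permanent
versus determinant; VP ≠ VNP is NOT proved and nothing in this file is progress on it.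

## References
* [BurgisserIkenmeyer2017] P. Bürgisser, C. Ikenmeyer, J. Algebra 477 (2017), Ex. 3.7 (L823),
  Rem. 3.13 (L1100), Def. 3.6.
* [FultonHarrisGTM129] W. Fulton, J. Harris, GTM 129, §15.5 (`Γ_{(c,…,c)} = det^c`).
* [DorflerIkenmeyerPanova2020] eqs. (4.3)–(4.4) (the formula behind the kernel plethysm values).

## Tree
`slInvariantsOfDegree_le_highestWeightSpace` (`BI17OddPlethysmColumnSets`); `isRationalRep_coordRep`
(`CoordRepRational`); `isHomogeneous_of_mem_highestWeightSpace` (`PlethysmLifting`);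
`apply_eq_self_of_mem_highestWeightSpace_const_of_det_eq_one` (`RectangularHighestWeightSemiInvariant`);
`mem_genericDegreeMonoid_iff_ne_bot`, `genericDegreeMonoid_four_four_of_mem`,
`mem_genericDegreeMonoid_three_three_of_even`, `not_mem_genericDegreeMonoid_three_three_of_le_three`,
`genericMinimalDegree_three_three`, `genericMinimalDegree_four_four`, `linComb_mem_genericDegreeMonoid`
(`BI17GenericDegreeMonoidSmallCases`); `plethysmCoeff_fin_four_cast_eq_dp` (`DIP20MonomialCountDP`);
`plethysmCoeff_fin_three_cast_eq_six_counts` (`DIP20PlethysmValuesRow3`);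
`mem_genericDegreeMonoid_self_of_even` (`BI17GenericMinimalDegreeProofs`).

Provenance: val-lit cell, prover val-lit-p4 g4 (registry claim #1 on `BI2017_ex_3_7`).
-/

namespace Literature.Computability.AlgebraicComplexity

open MvPolynomial
open _root_.Literature.NumberTheory.DiophantineGeometry

/-! ### §1 Invariants = highest-weight vectors of the rectangle -/

section Rectangle

variable {m D d : ℕ}

/-- **A highest-weight vector of constant weight in `ℂ[Sym^D (ℂ^m)]` is `SL_m`-invariant**
(`ℂ[Sym^D]` is a rational representation; `RectangularHighestWeightSemiInvariant`).
[cite: BurgisserIkenmeyer2017, Rem. 3.13] -/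
theorem isSLInvariantCoord_of_mem_highestWeightSpace_const {c : ℤ} {F : MvPolynomial (DegIdx (Fin m) D) ℂ}
    (hF : F ∈ highestWeightSpace (coordRep (Fin m) ℂ D) (fun _ : Fin m => c)) :
    IsSLInvariantCoord D F := fun g =>
  apply_eq_self_of_mem_highestWeightSpace_const_of_det_eq_one (isRationalRep_coordRep D) hF
    (by rw [Matrix.SpecialLinearGroup.coe_GL_coe_matrix]; exact g.det_coe)

/-- **`HW_{(-(Dd/m))^m}(ℂ[Sym^D]) ≤ O(Sym^D ℂ^m)^{SL_m}_d`** (`m ∣ Dd`, `D ≥ 1`): such a highest-weight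
vector is `SL_m`-invariant and — the weight pinning the degree — homogeneous of degree `d`.
[cite: BurgisserIkenmeyer2017, Rem. 3.13] -/
theorem highestWeightSpace_const_le_slInvariantsOfDegree (hD : 0 < D) (hdvd : m ∣ D * d) :
    highestWeightSpace (coordRep (Fin m) ℂ D) (fun _ : Fin m => -((D * d / m : ℕ) : ℤ)) ≤
      slInvariantsOfDegree (Fin m) ℂ D d := by
  intro F hF
  rw [mem_slInvariantsOfDegree_iff]
  refine ⟨?_, isSLInvariantCoord_of_mem_highestWeightSpace_const hF⟩
  haveI : Infinite ℂ := CharZero.infinite ℂ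
  refine isHomogeneous_of_mem_highestWeightSpace hD.ne' hF ?_
  have hms : (m : ℤ) * ((D * d / m : ℕ) : ℤ) = ((D * d : ℕ) : ℤ) := by
    exact_mod_cast Nat.mul_div_cancel' hdvd
  rw [Weight.size, Finset.sum_const, Finset.card_univ, Fintype.card_fin, nsmul_eq_mul, mul_neg, hms]

/-- **`O(Sym^D ℂ^m)^{SL_m}_d = HW_{(-(Dd/m))^m}(ℂ[Sym^D])`** (`m ≥ 1`, `D ≥ 1`, `m ∣ Dd`; BI 2017
Rem. 3.13: the invariants of degree `d` are spanned by the highest-weight vectors `P_T` of the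
rectangle `m × (Dd/m)`). [cite: BurgisserIkenmeyer2017, Rem. 3.13] -/
theorem slInvariantsOfDegree_eq_highestWeightSpace_const (hm : 0 < m) (hD : 0 < D) (hdvd : m ∣ D * d) :
    slInvariantsOfDegree (Fin m) ℂ D d =
      highestWeightSpace (coordRep (Fin m) ℂ D) (fun _ : Fin m => -((D * d / m : ℕ) : ℤ)) :=
  le_antisymm (slInvariantsOfDegree_le_highestWeightSpace hm hdvd)
    (highestWeightSpace_const_le_slInvariantsOfDegree hD hdvd)

/-- **`dim O(Sym^D ℂ^m)^{SL_m}_d = a_{((Dd/m)^m)}(d[D])`**, the plethysm coefficient of the rectangle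
(`m ≥ 1`, `D ≥ 1`, `m ∣ Dd`). [cite: BurgisserIkenmeyer2017, Rem. 3.13] -/
theorem finrank_slInvariantsOfDegree_eq_plethysmCoeff (hm : 0 < m) (hD : 0 < D) (hdvd : m ∣ D * d) :
    Module.finrank ℂ (slInvariantsOfDegree (Fin m) ℂ D d) =
      plethysmCoeff ℂ (Fin m) D (fun _ : Fin m => -((D * d / m : ℕ) : ℤ)) := by
  rw [slInvariantsOfDegree_eq_highestWeightSpace_const hm hD hdvd]
  rfl

/-- **`d ∈ E(D,m) ↔ a_{((Dd/m)^m)}(d[D]) ≠ 0`** (`m ≥ 1`, `D ≥ 1`, `m ∣ Dd`): every question about the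
generic degree monoid is a plethysm computation. [cite: BurgisserIkenmeyer2017, Def. 3.6] -/
theorem mem_genericDegreeMonoid_iff_plethysmCoeff_ne_zero (hm : 0 < m) (hD : 0 < D) (hdvd : m ∣ D * d) :
    d ∈ genericDegreeMonoid (Fin m) ℂ D ↔
      plethysmCoeff ℂ (Fin m) D (fun _ : Fin m => -((D * d / m : ℕ) : ℤ)) ≠ 0 := by
  haveI : FiniteDimensional ℂ
      (highestWeightSpace (coordRep (Fin m) ℂ D) (fun _ : Fin m => -((D * d / m : ℕ) : ℤ))) :=
    finiteDimensional_highestWeightSpace_coordRep_holds hD.ne' _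
  haveI : FiniteDimensional ℂ (slInvariantsOfDegree (Fin m) ℂ D d) :=
    Submodule.finiteDimensional_of_le (slInvariantsOfDegree_le_highestWeightSpace hm hdvd)
  rw [mem_genericDegreeMonoid_iff_ne_bot, ← finrank_slInvariantsOfDegree_eq_plethysmCoeff hm hD hdvd]
  exact not_congr Submodule.finrank_eq_zero.symm


end Rectangle

/-! ### §2 Kernel plethysm values: `a_{(6^4)}(6[4]) = a_{(7^4)}(7[4]) = a_{(6,6,6)}(6[3]) = 1` -/

section KernelValues

/-- **`a_{(6,6,6,6)}(6[4]) = 1`**: quaternary quartics have exactly one invariant of degree `6` up to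
scale (BI 2017 Ex. 3.7: `6 ∈ E(4,4)`). One packed table of the `c_ν(6,4)`
(`plethysmCoeff_fin_four_cast_eq_dp`, digit width `32`: `36^6 < 2^32`), `decide +kernel`.
[cite: BurgisserIkenmeyer2017, Ex. 3.7] -/
theorem plethysmCoeff_rowDual_six_six_six_six_four :
    plethysmCoeff ℂ (Fin 4) 4 (rowDual ![6, 6, 6, 6]) = 1 := by
  have h := plethysmCoeff_fin_four_cast_eq_dp ![6, 6, 6, 6] (n := 4) (d := 6) (F := 32)
    (by norm_num) (by decide) (by decide) (by decide) (by rw [Fin.sum_univ_four]; rfl) (by decide)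
    (by decide +kernel)
  have h2 : (plethysmCoeff ℂ (Fin 4) 4 (rowDual ![6, 6, 6, 6]) : ℤ) = 1 := by
    rw [h]
    decide +kernel
  exact_mod_cast h2

/-- **`a_{(7,7,7,7)}(7[4]) = 1`**: quaternary quartics have exactly one invariant of degree `7` up to
scale (BI 2017 Ex. 3.7: `7 ∈ E(4,4)`). One packed table of the `c_ν(7,4)`
(`plethysmCoeff_fin_four_cast_eq_dp`, digit width `37`: `36^7 < 2^37`), `decide +kernel`.
[cite: BurgisserIkenmeyer2017, Ex. 3.7] -/
theorem plethysmCoeff_rowDual_seven_seven_seven_seven_four :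
    plethysmCoeff ℂ (Fin 4) 4 (rowDual ![7, 7, 7, 7]) = 1 := by
  have h := plethysmCoeff_fin_four_cast_eq_dp ![7, 7, 7, 7] (n := 4) (d := 7) (F := 37)
    (by norm_num) (by decide) (by decide) (by decide) (by rw [Fin.sum_univ_four]; rfl) (by decide)
    (by decide +kernel)
  have h2 : (plethysmCoeff ℂ (Fin 4) 4 (rowDual ![7, 7, 7, 7]) : ℤ) = 1 := by
    rw [h]
    decide +kernel
  exact_mod_cast h2

/-- **`a_{(6,6,6)}(6[3]) = 1`**: ternary cubics have exactly one invariant of degree `6` up to scale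
(Aronhold's `T`; BI 2017 Ex. 3.7: `6 ∈ E(3,3)`). By DIP (4.4) over `𝔖₃` as six naive monomial counts
(`plethysmCoeff_fin_three_cast_eq_six_counts`, val-lit-p6), `decide`.
[cite: BurgisserIkenmeyer2017, Ex. 3.7] -/
theorem plethysmCoeff_rowDual_six_six_six_three :
    plethysmCoeff ℂ (Fin 3) 3 (rowDual ![6, 6, 6]) = 1 := by
  have h := plethysmCoeff_fin_three_cast_eq_six_counts 6 6 6 (n := 3) (d := 6) (by norm_num)
    (by norm_num) (by norm_num) (by norm_num)
  have h2 : (plethysmCoeff ℂ (Fin 3) 3 (rowDual ![6, 6, 6]) : ℤ) = 1 := by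
    rw [h]
    decide +kernel
  exact_mod_cast h2

/-- `6 ∈ E(4,4)`. [cite: BurgisserIkenmeyer2017, Ex. 3.7] -/
theorem six_mem_genericDegreeMonoid_four_four : 6 ∈ genericDegreeMonoid (Fin 4) ℂ 4 := by
  rw [mem_genericDegreeMonoid_iff_plethysmCoeff_ne_zero (by norm_num) (by norm_num) ⟨6, by norm_num⟩]
  have h : (fun _ : Fin 4 => -((4 * 6 / 4 : ℕ) : ℤ)) = rowDual ![6, 6, 6, 6] := by
    funext i
    fin_cases i <;> simp [rowDual, Weight.dual]
  rw [h, plethysmCoeff_rowDual_six_six_six_six_four]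
  exact one_ne_zero

/-- `7 ∈ E(4,4)`. [cite: BurgisserIkenmeyer2017, Ex. 3.7] -/
theorem seven_mem_genericDegreeMonoid_four_four : 7 ∈ genericDegreeMonoid (Fin 4) ℂ 4 := by
  rw [mem_genericDegreeMonoid_iff_plethysmCoeff_ne_zero (by norm_num) (by norm_num) ⟨7, by norm_num⟩]
  have h : (fun _ : Fin 4 => -((4 * 7 / 4 : ℕ) : ℤ)) = rowDual ![7, 7, 7, 7] := by
    funext i
    fin_cases i <;> simp [rowDual, Weight.dual]
  rw [h, plethysmCoeff_rowDual_seven_seven_seven_seven_four]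
  exact one_ne_zero

/-- `6 ∈ E(3,3)` (Aronhold's invariant `T`). [cite: BurgisserIkenmeyer2017, Ex. 3.7] -/
theorem six_mem_genericDegreeMonoid_three_three : 6 ∈ genericDegreeMonoid (Fin 3) ℂ 3 := by
  rw [mem_genericDegreeMonoid_iff_plethysmCoeff_ne_zero (by norm_num) (by norm_num) ⟨6, by norm_num⟩]
  have h : (fun _ : Fin 3 => -((3 * 6 / 3 : ℕ) : ℤ)) = rowDual ![6, 6, 6] := by
    funext i
    fin_cases i <;> simp [rowDual, Weight.dual]
  rw [h, plethysmCoeff_rowDual_six_six_six_three]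
  exact one_ne_zero

end KernelValues

/-! ### §3 BI 2017 Ex. 3.7: `E(4,4)` proved; `E(3,3) ⊇ 2(ℕ ∖ {1})`; `E(2,2) ⊇ 2ℕ` -/

section Example

/-- **BI 2017, Example 3.7, `E(4,4) = {0,4,6,7,8,10,11,…} = ℕ ∖ {1,2,3,5,9}` — PROVED**
(in print "computed with the SCHUR package"; here: `4` by Cayley's `P_{4,4}`, `6, 7` by the kernel
plethysm values of §2 and §1, sums by the monoid property, the five gaps by Howe's theorem
(`1,2,3`) and the kernel zeros `a_{(5^4)}(5[4]) = a_{(9^4)}(9[4]) = 0`).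
[cite: BurgisserIkenmeyer2017, Ex. 3.7] -/
theorem genericDegreeMonoid_four_four :
    genericDegreeMonoid (Fin 4) ℂ 4 = {d | d ≠ 1 ∧ d ≠ 2 ∧ d ≠ 3 ∧ d ≠ 5 ∧ d ≠ 9} :=
  genericDegreeMonoid_four_four_of_mem six_mem_genericDegreeMonoid_four_four
    seven_mem_genericDegreeMonoid_four_four

/-- `E(3,3) ⊇ 2(ℕ ∖ {1})`: every even `d ≠ 2` lies in `E(3,3)` (`4` by `P_3`, `6` by §2, sums).
[cite: BurgisserIkenmeyer2017, Ex. 3.7] -/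
theorem mem_genericDegreeMonoid_three_three_of_even' {d : ℕ} (hd : Even d) (hd2 : d ≠ 2) :
    d ∈ genericDegreeMonoid (Fin 3) ℂ 3 :=
  mem_genericDegreeMonoid_three_three_of_even six_mem_genericDegreeMonoid_three_three hd hd2

/-- `E(2,2) ⊇ 2ℕ`: every even `d` lies in `E(2,2)` (the discriminant `P_{2,2}` has degree `2`, and its
powers). [cite: BurgisserIkenmeyer2017, Ex. 3.7] -/
theorem mem_genericDegreeMonoid_two_two_of_even {d : ℕ} (hd : Even d) :
    d ∈ genericDegreeMonoid (Fin 2) ℂ 2 := by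
  obtain ⟨j, rfl⟩ := hd
  have h2 : 2 ∈ genericDegreeMonoid (Fin 2) ℂ 2 :=
    mem_genericDegreeMonoid_self_of_even (by decide) (by norm_num) le_rfl
  have := linComb_mem_genericDegreeMonoid h2 (zero_mem_genericDegreeMonoid (σ := Fin 2) (k := ℂ) (D := 2))
    (zero_mem_genericDegreeMonoid (σ := Fin 2) (k := ℂ) (D := 2)) j 0 0
  simpa [two_mul] using this

/-- `E(3,3) ⊆ 2(ℕ ∖ {1})` GIVEN the odd-degree vanishing `a_{(d,d,d)}(d[3]) = 0` for odd `d` (Aronhold: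
the invariants of ternary cubics are `ℂ[S,T]`, `deg S = 4`, `deg T = 6`; not a finite computation).
[cite: BurgisserIkenmeyer2017, Ex. 3.7] -/
theorem genericDegreeMonoid_three_three_of_odd_vanishing
    (h33 : ∀ d : ℕ, Odd d → plethysmCoeff ℂ (Fin 3) 3 (fun _ : Fin 3 => -(d : ℤ)) = 0) :
    genericDegreeMonoid (Fin 3) ℂ 3 = {d | Even d ∧ d ≠ 2} := by
  ext d
  refine ⟨fun hd => ⟨?_, ?_⟩, fun hd => mem_genericDegreeMonoid_three_three_of_even' hd.1 hd.2⟩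
  · by_contra hodd
    rw [Nat.not_even_iff_odd] at hodd
    have h0 := h33 d hodd
    have hdvd : 3 ∣ 3 * d := ⟨d, rfl⟩
    rw [mem_genericDegreeMonoid_iff_plethysmCoeff_ne_zero (by norm_num) (by norm_num) hdvd] at hd
    rw [show (3 * d / 3 : ℕ) = d from Nat.mul_div_cancel_left d (by norm_num)] at hd
    exact hd h0
  · rintro rfl
    exact not_mem_genericDegreeMonoid_three_three_of_le_three (by norm_num) (by norm_num) hd

/-- `E(2,2) ⊆ 2ℕ` GIVEN the odd-degree vanishing `a_{(d,d)}(d[2]) = 0` for odd `d` (the invariants of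
binary quadrics are `ℂ[disc]`; discharged in a sibling file). [cite: BurgisserIkenmeyer2017, Ex. 3.7] -/
theorem genericDegreeMonoid_two_two_of_odd_vanishing
    (h22 : ∀ d : ℕ, Odd d → plethysmCoeff ℂ (Fin 2) 2 (fun _ : Fin 2 => -(d : ℤ)) = 0) :
    genericDegreeMonoid (Fin 2) ℂ 2 = {d | Even d} := by
  ext d
  refine ⟨fun hd => ?_, fun hd => mem_genericDegreeMonoid_two_two_of_even hd⟩
  by_contra hodd
  change ¬ Even d at hodd
  rw [Nat.not_even_iff_odd] at hodd
  have h0 := h22 d hodd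
  have hdvd : 2 ∣ 2 * d := ⟨d, rfl⟩
  rw [mem_genericDegreeMonoid_iff_plethysmCoeff_ne_zero (by norm_num) (by norm_num) hdvd] at hd
  rw [show (2 * d / 2 : ℕ) = d from Nat.mul_div_cancel_left d (by norm_num)] at hd
  exact hd h0

/-- **BI 2017 Example 3.7, REDUCED to the two odd-degree vanishing statements** (binary quadrics and
ternary cubics have no invariants of odd degree): given those, the named fact `BI2017_ex_3_7` holds —
`E(2,2) = 2ℕ`, `E(3,3) = 2(ℕ ∖ {1})`, `e(3,3) = 4`, `E(4,4) = ℕ ∖ {1,2,3,5,9}`, `e(4,4) = 4`, the last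
three unconditionally (`genericMinimalDegree_three_three`, `genericDegreeMonoid_four_four`,
`genericMinimalDegree_four_four`). [cite: BurgisserIkenmeyer2017, Ex. 3.7] -/
theorem BI2017_ex_3_7_of_odd_vanishing
    (h22 : ∀ d : ℕ, Odd d → plethysmCoeff ℂ (Fin 2) 2 (fun _ : Fin 2 => -(d : ℤ)) = 0)
    (h33 : ∀ d : ℕ, Odd d → plethysmCoeff ℂ (Fin 3) 3 (fun _ : Fin 3 => -(d : ℤ)) = 0) :
    BI2017_ex_3_7 :=
  ⟨genericDegreeMonoid_two_two_of_odd_vanishing h22,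
    genericDegreeMonoid_three_three_of_odd_vanishing h33, genericMinimalDegree_three_three,
    genericDegreeMonoid_four_four, genericMinimalDegree_four_four⟩

end Example

end Literature.Computability.AlgebraicComplexity
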